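import Literature.Topology.FourManifolds.ClosedModelAmbientCollapse
import Literature.AlgebraicTopology.SingularHomology.LefschetzDualityProofs
import Literature.AlgebraicTopology.SingularHomology.CechCapBridge
import Literature.AlgebraicTopology.SingularHomology.UniversalCoefficientsProofs
import Literature.AlgebraicTopology.SingularHomology.PoincareDuality
import HarnessLib

/-!
# Novikov additivity: classes orthogonal to a piece restrict to torsion on that piece

R. Kirby, *The topology of 4-manifolds*, LNM 1374 (1989), Ch. II §5, proof of Thm. 5.3
(Novikov additivity): the part of `H₂(M₁ ∪_∂ M₂)` orthogonal to (the images of) `H₂(M₁)` and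
`H₂(M₂)` comes from the separating 3-manifold.  In the cohomological organisation of the proof
used by the tree this is the following **support lemma**, proved here in abstract form for one
compact piece `W` (a null-cobordism `c`, closed model `Ŵ = W ∪ cone ∂W` with collapse
`q : (W, ∂W) → (Ŵ, ∞)`) sitting in a space `P` carrying a `ℤ`-orientation class `[P]` (a closed oriented manifold in the
application) by a map of pairs
`j : (W, ∂W) → (P, A)` inducing isomorphisms `Hₖ(W, ∂W) ≅ Hₖ(P, A)` (for a boundary gluing
`P = M ∪_φ W`, `A = M`: `BoundaryGluingData.isIso_map_jB_boundary'`), a relative fundamental class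
`w` of `W` with `j_* w = j_A [P]`, and a collapse `π : P → Ŵ` with `π ∘ j = q`, `π(A) = ∞`:

* `NullCobordism.exists_smul_cohomologyMap_eq_zero_of_forall_kroneckerPairing_eq_zero` — if
  `x ∈ Hᵖ(P; ℤ)` is such that its Poincaré dual `z = x ⌢ [P]` is killed by every class of `Hq(Ŵ)`
  after `π_*` (i.e. `⟨x ⌣ π^* a, [P]⟩ = 0` for all `a`: `x` is orthogonal to `π^* Hq(Ŵ)` for the
  cup product pairing), then **`n • j^* x = 0` in `Hᵖ(W; ℤ)` for some `n ≠ 0`**.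
  Proof: `π_* z` is torsion (universal coefficients: the Kronecker map is onto,
  `kroneckerPairing_surjective`, and linear forms detect non-torsion elements of a finitely
  generated module, `exists_smul_eq_zero_of_forall_dual_eq_zero`); writing `j_A z = j_* ζ`,
  `q_* ζ = j_∞ π_* z`, so `n ζ = 0` (`q_*` is an isomorphism, `isIso_map_boundaryCollapse`) and
  `j_A (n z) = 0`; by the projection formula `j_* (j^* x ⌢ w) = x ⌢ j_* w = x ⌢ j_A [P] = j_A z`
  (`map_relCapProduct`, `relCapProduct_ofAbsolute`), so `n (j^* x ⌢ w) = 0` (`j_*` injective) and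
  `n j^* x = 0` by Lefschetz duality (`bijective_relCapProduct_of_isRelFundamentalClass_holds`).

Everything is proved; no definitions, no named facts.

## References

* R. C. Kirby, *The topology of 4-manifolds*, LNM 1374, Springer 1989, Ch. II §5, Thm. 5.3
  (proof). [Kirby1989]
* A. Hatcher, *Algebraic Topology*, CUP 2002, §3.1 Thm. 3.2 (universal coefficients), §3.3
  p. 241 (projection formula), Thm. 3.43 (Lefschetz duality). [HatcherAT2002]
-/

noncomputable section

open scoped Manifold ContDiff Topology
open Set Function Filter CategoryTheory Limits
open Literature.AlgebraicTopology.SingularHomology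

namespace Literature.Topology.FourManifolds

/-! ### Linear forms detect non-torsion elements -/

/-- **An element of a finitely generated module over a principal ideal domain killed by every
linear form is torsion**: `M ⧸ T` is finitely generated and torsion-free, hence free, so its points
are separated by linear forms (Mathlib's `Module.forall_dual_apply_eq_zero_iff`), and an element
mapping to `0` in `M ⧸ T` is torsion (Hatcher 2002, §3.1, p. 196: "`Hom(H, ℤ)` … can be identified
with the free part of `H`"). [cite: HatcherAT2002, §3.1 p. 196] -/
theorem exists_smul_eq_zero_of_forall_dual_eq_zero {R : Type*} [CommRing R] [IsDomain R]
    [IsPrincipalIdealRing R] {M : Type*} [AddCommGroup M] [Module R M] [Module.Finite R M]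
    (u : M) (h : ∀ f : Module.Dual R M, f u = 0) :
    ∃ r : R, r ≠ 0 ∧ r • u = 0 := by
  set T := Submodule.torsion R M with hT
  haveI : Module.IsTorsionFree R (M ⧸ T) :=
    inferInstanceAs (Module.IsTorsionFree R (M ⧸ Submodule.torsion R M))
  haveI : Module.Free R (M ⧸ T) := Module.free_of_finite_type_torsion_free'
  have hq : T.mkQ u = 0 := by
    refine (Module.forall_dual_apply_eq_zero_iff R (T.mkQ u)).1 fun f => ?_
    exact h (f ∘ₗ T.mkQ)
  rw [Submodule.mkQ_apply, Submodule.Quotient.mk_eq_zero, hT, Submodule.mem_torsion_iff] at hq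
  obtain ⟨a, ha⟩ := hq
  exact ⟨a, nonZeroDivisors.coe_ne_zero a, by rwa [Submonoid.smul_def] at ha⟩

namespace NullCobordism

variable {m : ℕ}
variable {S' : Type} [TopologicalSpace S'] [ChartedSpace (EuclideanSpace ℝ (Fin (m + 1))) S']
  [IsManifold (𝓡 (m + 1)) ∞ S'] [CompactSpace S'] [Nonempty S']
variable (c : NullCobordism (m + 1) S')
variable {P : Type} [TopologicalSpace P]

/-- **Classes orthogonal to a piece restrict to torsion on that piece** (the cohomological core
of Kirby 1989, proof of Thm. 5.3; see the module docstring for the setting and the proof).  Data: a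
map of pairs `j : (W, ∂W) → (P, A)` inducing isomorphisms on `H_q` and `Hₘ₊₂` of the pairs, a
relative fundamental class `w` of `(W, ∂W)` with `j_* w = j_A [P]`, a collapse `π : P → Ŵ` with
`π ∘ j = q` and `π(A) ⊆ {∞}`, `Hq(Ŵ; ℤ)` finitely generated, and `x ∈ Hᵖ(P; ℤ)`, `p + q = m + 2`,
with `⟨a, π_* (x ⌢ [P])⟩ = 0` for all `a ∈ Hq(Ŵ; ℤ)`.  Conclusion: `j^* (n • x) = 0` for some
`n ≠ 0`. [cite: Kirby1989, Ch. II §5, Thm. 5.3 (proof)] -/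
theorem exists_smul_cohomologyMap_eq_zero_of_forall_kroneckerPairing_eq_zero
    (μ : HomologicalOrientation ℤ P (m + 1 + 1)) {A : Set P} (j : C(c.W, P))
    (hj : MapsTo j ((𝓡∂ (m + 1 + 1)).boundary c.W) A) {p q : ℕ} (h : p + q = m + 1 + 1)
    [IsIso (relativeSingularHomology.map ℤ ℤ j hj q)]
    [IsIso (relativeSingularHomology.map ℤ ℤ j hj (m + 1 + 1))]
    (w : relativeSingularHomology ℤ ℤ c.W ((𝓡∂ (m + 1 + 1)).boundary c.W) (m + 1 + 1))
    (hw : relativeSingularHomology.map ℤ ℤ j hj (m + 1 + 1) w =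
      relativeSingularHomology.ofAbsolute ℤ ℤ P A (m + 1 + 1) μ.fundamentalClass)
    (hwf : IsRelFundamentalClass ℤ ((𝓡∂ (m + 1 + 1)).boundary c.W) w)
    (π : C(P, ClosedModel (m + 1) c.W)) (hπj : π.comp j = boundaryCollapse (m + 1) c.W)
    (hπA : MapsTo π A ({ClosedModel.infty} : Set (ClosedModel (m + 1) c.W)))
    [Module.Finite ℤ (singularHomology ℤ ℤ (ClosedModel (m + 1) c.W) q)]
    (x : singularCohomology ℤ ℤ P p)
    (hx : ∀ a : singularCohomology ℤ ℤ (ClosedModel (m + 1) c.W) q,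
      kroneckerPairing ℤ ℤ (ClosedModel (m + 1) c.W) q a
        (singularHomology.map ℤ ℤ π q (poincareDualityMap μ h x)) = 0) :
    ∃ n : ℤ, n ≠ 0 ∧ singularCohomology.map ℤ ℤ j p (n • x) = 0 := by
  set z := poincareDualityMap μ h x with hz
  -- (1) `π_* z` is torsion
  have hdual : ∀ f : Module.Dual ℤ (singularHomology ℤ ℤ (ClosedModel (m + 1) c.W) q),
      f (singularHomology.map ℤ ℤ π q z) = 0 := fun f => by
    obtain ⟨a, rfl⟩ := kroneckerPairing_surjective (R := ℤ) (X := ClosedModel (m + 1) c.W) q f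
    exact hx a
  obtain ⟨n, hn, hnu⟩ := exists_smul_eq_zero_of_forall_dual_eq_zero _ hdual
  -- read the exotic `ℤ`-action of the module structure as the canonical one
  have hnu' : n • singularHomology.map ℤ ℤ π q z = 0 := by
    rw [← int_smul_eq_zsmul (inferInstance : Module ℤ (singularHomology ℤ ℤ (ClosedModel (m + 1) c.W) q))]
    exact hnu
  refine ⟨n, hn, ?_⟩
  -- (2) `j_A (n • z) = 0`
  have hbij : Function.Bijective (relativeSingularHomology.map ℤ ℤ j hj q) :=
    ⟨(ModuleCat.mono_iff_injective _).1 inferInstance, (ModuleCat.epi_iff_surjective _).1 inferInstance⟩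
  obtain ⟨ζ, hζ⟩ := hbij.2 (relativeSingularHomology.ofAbsolute ℤ ℤ P A q z)
  obtain ⟨κ⟩ := BoundaryData.nonempty_collar_of_compactSpace m c.W c.boundaryData
  haveI := c.isIso_map_boundaryCollapse κ ℤ ℤ q
  have hqζ : relativeSingularHomology.map ℤ ℤ (boundaryCollapse (m + 1) c.W)
        (mapsTo_boundaryCollapse (m + 1) c.W) q ζ =
      relativeSingularHomology.ofAbsolute ℤ ℤ (ClosedModel (m + 1) c.W) {ClosedModel.infty} q
        (singularHomology.map ℤ ℤ π q z) := by
    have e1 : relativeSingularHomology.map ℤ ℤ (boundaryCollapse (m + 1) c.W)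
          (mapsTo_boundaryCollapse (m + 1) c.W) q =
        relativeSingularHomology.map ℤ ℤ j hj q ≫ relativeSingularHomology.map ℤ ℤ π hπA q := by
      rw [← relativeSingularHomology.map_comp]
      exact relativeSingularHomology.map_congr ℤ ℤ hπj.symm _ _ q
    rw [e1, ModuleCat.comp_apply, hζ, ← ModuleCat.comp_apply,
      relativeSingularHomology.ofAbsolute_comp_map, ModuleCat.comp_apply]
  have hnζ : n • ζ = 0 := by
    apply (ModuleCat.mono_iff_injective (relativeSingularHomology.map ℤ ℤ (boundaryCollapse (m + 1) c.W)
      (mapsTo_boundaryCollapse (m + 1) c.W) q)).1 inferInstance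
    rw [map_zero, map_zsmul, hqζ, ← map_zsmul, hnu', map_zero]
  have hAz : relativeSingularHomology.ofAbsolute ℤ ℤ P A q (n • z) = 0 := by
    rw [map_zsmul, ← hζ, ← map_zsmul, hnζ, map_zero]
  -- (3) projection formula and Lefschetz duality, for the class `j^* (n • x)`
  have hproj : relativeSingularHomology.map ℤ ℤ j hj q
      (relCapProduct (M := ℤ) ((𝓡∂ (m + 1 + 1)).boundary c.W) h
        (singularCohomology.map ℤ ℤ j p (n • x)) w) =
      relativeSingularHomology.ofAbsolute ℤ ℤ P A q (n • z) := by
    rw [relativeSingularHomology.map_relCapProduct (M := ℤ) j hj h (n • x) w, hw,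
      relCapProduct_ofAbsolute, ← poincareDualityMap_apply, map_zsmul]
  have hcap : relCapProduct (M := ℤ) ((𝓡∂ (m + 1 + 1)).boundary c.W) h
      (singularCohomology.map ℤ ℤ j p (n • x)) w = 0 := by
    apply hbij.1
    rw [hproj, hAz, map_zero]
  have hL := bijective_relCapProduct_of_isRelFundamentalClass_holds (R := ℤ) (m + 1) c.W w hwf h
  exact hL.1 (by simp only [hcap, map_zero, LinearMap.zero_apply])

end NullCobordism

end Literature.Topology.FourManifolds

end
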